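import Literature.Computability.Complexity.GraphCanonizationScheme
import HarnessLib

/-!
# Final parts, node count and chain product of the section/individualization canoniser

Bookkeeping for the size analysis (`GraphCanonizationSchemeSize.lean`) of `CGCanon.canon`
(`GraphCanonizationScheme.lean`; [CorneilGoldberg1984], [Laubner2011, §3.4–3.5]):

* `CGCanon.fparts G W c` — the FINAL PARTS of a state: split along the components of the
  switched graph repeatedly until every part is connected (or trivial). They lie in `W`, are
  nonempty when `W` is, connected-or-trivial, pairwise disjoint; every vertex of `W` outside a
  final part `K` is homogeneous to every cell of `K` (`adj_iff_adj_of_mem_fparts`, iterating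
  [Laubner2011, Prop. 3.3.4]); equitability restricts to them (`IsEqui.of_mem_fparts`).
* `CGCanon.cost R G W c` — the number of nodes of the recursion tree of `canon R G W c` (same
  recursion, `1 +` the sum over the children);
* `CGCanon.lam R G W c` — the CHAIN PRODUCT: the largest product of branching degrees `|A|` along
  a chain of the recursion (`|A| ·` the max over the children at individualization nodes, the max
  over the parts at section nodes);
* `cost_succ_le` — **`cost + 1 ≤ 2 |W| · lam`** (sections are additive, so only chains of
  branchings multiply); `lam_le_sup_fparts` — the chain product of a state is at most the largest
  chain product of its final parts.

## References

* D. G. Corneil, M. K. Goldberg, J. Algorithms 5 (1984) 345–362. [CorneilGoldberg1984]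
* B. Laubner, PhD thesis, HU Berlin 2011, doi:10.18452/16335, §3.4 (recursion tree), §3.5. [Laubner2011]
-/

namespace Literature.Computability.Complexity

open Literature.Combinatorics.SimpleGraph Finset ColourRefinementScheme

open scoped Classical

noncomputable section

namespace CGCanon

variable {k : ℕ}

/-! ### Final parts -/

/-- **The final parts** of a state: `{W}` if the state is connected or has at most one vertex,
otherwise the final parts of its parts. [cite: Laubner2011, §3.4 step 2 (iterated)] -/
def fparts (G : SimpleGraph (Fin k)) : Finset (Fin k) → (Fin k → ℕ) → Finset (Finset (Fin k))
  | W, c =>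
    if h : IsConn G W c ∨ W.card ≤ 1 then {W}
    else (parts G W c).attach.biUnion fun K =>
      have := card_lt_of_mem_parts (fun h' => h (Or.inl h')) K.2
      fparts G K.1 c
termination_by W _ => W.card

variable {G : SimpleGraph (Fin k)} {W : Finset (Fin k)} {c : Fin k → ℕ}

/-- Unfolding, connected-or-trivial case. [folklore] -/
theorem fparts_of_stop (h : IsConn G W c ∨ W.card ≤ 1) : fparts G W c = {W} := by
  rw [fparts]; simp [h]

/-- Unfolding, section case. [folklore] -/
theorem fparts_of_not_stop (h : ¬ (IsConn G W c ∨ W.card ≤ 1)) :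
    fparts G W c = (parts G W c).attach.biUnion fun K => fparts G K.1 c := by
  rw [fparts]; simp [h]

/-- Membership, section case. [folklore] -/
theorem mem_fparts_of_not_stop (h : ¬ (IsConn G W c ∨ W.card ≤ 1)) {K : Finset (Fin k)} :
    K ∈ fparts G W c ↔ ∃ K₀ ∈ parts G W c, K ∈ fparts G K₀ c := by
  rw [fparts_of_not_stop h, mem_biUnion]
  constructor
  · rintro ⟨K₀, -, hK⟩; exact ⟨K₀.1, K₀.2, hK⟩
  · rintro ⟨K₀, hK₀, hK⟩; exact ⟨⟨K₀, hK₀⟩, mem_attach _ _, hK⟩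

/-- Final parts lie in `W`. [folklore] -/
theorem subset_of_mem_fparts : ∀ {W : Finset (Fin k)} {K : Finset (Fin k)}, K ∈ fparts G W c → K ⊆ W := by
  intro W
  induction W using Finset.strongInduction with
  | H W ih =>
  intro K hK
  by_cases h : IsConn G W c ∨ W.card ≤ 1
  · rw [fparts_of_stop h, mem_singleton] at hK; exact hK ▸ Subset.rfl
  · obtain ⟨K₀, hK₀, hK⟩ := (mem_fparts_of_not_stop h).1 hK
    have hlt := card_lt_of_mem_parts (fun h' => h (Or.inl h')) hK₀
    have hsub : K₀ ⊆ W := by obtain ⟨u, -, rfl⟩ := mem_image.1 hK₀; exact comp_subset u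
    exact (ih K₀ (hsub.ssubset_of_ne fun e => by rw [e] at hlt; exact lt_irrefl _ hlt) hK).trans hsub

/-- Final parts are connected or trivial. [folklore] -/
theorem stop_of_mem_fparts : ∀ {W : Finset (Fin k)} {K : Finset (Fin k)}, K ∈ fparts G W c → IsConn G K c ∨ K.card ≤ 1 := by
  intro W
  induction W using Finset.strongInduction with
  | H W ih =>
  intro K hK
  by_cases h : IsConn G W c ∨ W.card ≤ 1
  · rw [fparts_of_stop h, mem_singleton] at hK; exact hK ▸ h
  · obtain ⟨K₀, hK₀, hK⟩ := (mem_fparts_of_not_stop h).1 hK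
    have hlt := card_lt_of_mem_parts (fun h' => h (Or.inl h')) hK₀
    have hsub : K₀ ⊆ W := by obtain ⟨u, -, rfl⟩ := mem_image.1 hK₀; exact comp_subset u
    exact ih K₀ (hsub.ssubset_of_ne fun e => by rw [e] at hlt; exact lt_irrefl _ hlt) hK

/-- Final parts of a nonempty state are nonempty. [folklore] -/
theorem nonempty_of_mem_fparts : ∀ {W : Finset (Fin k)} {K : Finset (Fin k)}, W.Nonempty → K ∈ fparts G W c → K.Nonempty := by
  intro W
  induction W using Finset.strongInduction with
  | H W ih =>
  intro K hW hK
  by_cases h : IsConn G W c ∨ W.card ≤ 1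
  · rw [fparts_of_stop h, mem_singleton] at hK; exact hK ▸ hW
  · obtain ⟨K₀, hK₀, hK⟩ := (mem_fparts_of_not_stop h).1 hK
    have hlt := card_lt_of_mem_parts (fun h' => h (Or.inl h')) hK₀
    obtain ⟨u, hu, rfl⟩ := mem_image.1 hK₀
    exact ih _ ((comp_subset u).ssubset_of_ne fun e => by rw [e] at hlt; exact lt_irrefl _ hlt) ⟨u, mem_comp_self hu⟩ hK

/-- **Homogeneity across a final part**: a vertex of `W` outside a final part `K` is adjacent to
all or to none of the vertices of `K` of any given colour. [cite: Laubner2011, Prop. 3.3.4] -/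
theorem adj_iff_adj_of_mem_fparts : ∀ {W : Finset (Fin k)} {K : Finset (Fin k)}, K ∈ fparts G W c →
    ∀ {u v w : Fin k}, u ∈ W → u ∉ K → v ∈ K → w ∈ K → c v = c w → (G.Adj u v ↔ G.Adj u w) := by
  intro W
  induction W using Finset.strongInduction with
  | H W ih =>
  intro K hK u v w hu huK hv hw hcol
  by_cases h : IsConn G W c ∨ W.card ≤ 1
  · rw [fparts_of_stop h, mem_singleton] at hK; subst hK; exact absurd hu huK
  · obtain ⟨K₀, hK₀, hK⟩ := (mem_fparts_of_not_stop h).1 hK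
    have hlt := card_lt_of_mem_parts (fun h' => h (Or.inl h')) hK₀
    obtain ⟨a, ha, rfl⟩ := mem_image.1 hK₀
    have hKK₀ : K ⊆ comp G W c a := subset_of_mem_fparts hK
    by_cases hu₀ : u ∈ comp G W c a
    · exact ih _ ((comp_subset a).ssubset_of_ne fun e => by rw [e] at hlt; exact lt_irrefl _ hlt) hK hu₀ huK hv hw hcol
    · exact adj_iff_adj_of_closed (comp_closed a) hu hu₀ (hKK₀ hv) (hKK₀ hw) hcol

/-- **Equitability restricts to final parts.** [cite: Laubner2011, §3.4] -/
theorem IsEqui.of_mem_fparts : ∀ {W : Finset (Fin k)} {K : Finset (Fin k)}, IsEqui G W c → K ∈ fparts G W c → IsEqui G K c := by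
  intro W
  induction W using Finset.strongInduction with
  | H W ih =>
  intro K hE hK
  by_cases h : IsConn G W c ∨ W.card ≤ 1
  · rw [fparts_of_stop h, mem_singleton] at hK; exact hK ▸ hE
  · obtain ⟨K₀, hK₀, hK⟩ := (mem_fparts_of_not_stop h).1 hK
    have hlt := card_lt_of_mem_parts (fun h' => h (Or.inl h')) hK₀
    obtain ⟨a, -, rfl⟩ := mem_image.1 hK₀
    exact ih _ ((comp_subset a).ssubset_of_ne fun e => by rw [e] at hlt; exact lt_irrefl _ hlt) (hE.of_closed (comp_closed a)) hK

/-! ### Node count and chain product -/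

variable (R : Refiner k) (G : SimpleGraph (Fin k))

/-- **The number of nodes of the recursion tree** of `canon R G W c`. [cite: Laubner2011, §3.4 (the recursion tree `T`)] -/
def cost : Finset (Fin k) → (Fin k → ℕ) → ℕ
  | W, c =>
    if W.card ≤ 1 then 1
    else if hconn : IsConn G W c then
      if (bigMinCell W c).Nonempty then
        1 + ∑ x ∈ (bigMinCell W c).attach,
          have := measure_lt_of_mem_bigMinCell R G W c x.2
          cost W (R.refine G W (individualize c x.1))
      else 1
    else 1 + ∑ K ∈ (parts G W c).attach,
        have := card_lt_of_mem_parts hconn K.2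
        cost K.1 c
termination_by W c => (W.card, W.card - (W.image c).card)
decreasing_by
  · exact Prod.Lex.right _ this
  · exact Prod.Lex.left _ _ this

/-- **The chain product**: the largest product of branching degrees along a chain. [cite: Laubner2011, §3.5 (`d₁ ⋯ d_h`)] -/
def lam : Finset (Fin k) → (Fin k → ℕ) → ℕ
  | W, c =>
    if W.card ≤ 1 then 1
    else if hconn : IsConn G W c then
      if (bigMinCell W c).Nonempty then
        (bigMinCell W c).card * (bigMinCell W c).attach.sup fun x =>
          have := measure_lt_of_mem_bigMinCell R G W c x.2
          lam W (R.refine G W (individualize c x.1))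
      else 1
    else (parts G W c).attach.sup fun K =>
        have := card_lt_of_mem_parts hconn K.2
        lam K.1 c
termination_by W c => (W.card, W.card - (W.image c).card)
decreasing_by
  · exact Prod.Lex.right _ this
  · exact Prod.Lex.left _ _ this

variable {R G}

/-- Unfolding `cost`, trivial states. [folklore] -/
theorem cost_of_card_le_one (h : W.card ≤ 1) : cost R G W c = 1 := by rw [cost]; simp [h]

/-- Unfolding `cost`, individualization nodes. [folklore] -/
theorem cost_of_isConn (hW : ¬ W.card ≤ 1) (h : IsConn G W c) (hA : (bigMinCell W c).Nonempty) :
    cost R G W c = 1 + ∑ x ∈ (bigMinCell W c).attach, cost R G W (R.refine G W (individualize c x.1)) := by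
  rw [cost]; simp [hW, h, hA]

/-- Unfolding `cost`, degenerate connected states. [folklore] -/
theorem cost_of_isConn_of_not_nonempty (hW : ¬ W.card ≤ 1) (h : IsConn G W c) (hA : ¬ (bigMinCell W c).Nonempty) :
    cost R G W c = 1 := by rw [cost]; simp [hW, h, hA]

/-- Unfolding `cost`, section nodes (`1 +` the parts). [folklore] -/
theorem cost_of_not_isConn (hW : ¬ W.card ≤ 1) (h : ¬ IsConn G W c) :
    cost R G W c = 1 + ∑ K ∈ (parts G W c).attach, cost R G K.1 c := by
  rw [cost]; simp [hW, h]

/-- Unfolding `lam`, trivial states. [folklore] -/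
theorem lam_of_card_le_one (h : W.card ≤ 1) : lam R G W c = 1 := by rw [lam]; simp [h]

/-- Unfolding `lam`, individualization nodes. [folklore] -/
theorem lam_of_isConn (hW : ¬ W.card ≤ 1) (h : IsConn G W c) (hA : (bigMinCell W c).Nonempty) :
    lam R G W c = (bigMinCell W c).card * (bigMinCell W c).attach.sup fun x => lam R G W (R.refine G W (individualize c x.1)) := by
  rw [lam]; simp [hW, h, hA]

/-- Unfolding `lam`, degenerate connected states. [folklore] -/
theorem lam_of_isConn_of_not_nonempty (hW : ¬ W.card ≤ 1) (h : IsConn G W c) (hA : ¬ (bigMinCell W c).Nonempty) :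
    lam R G W c = 1 := by rw [lam]; simp [hW, h, hA]

/-- Unfolding `lam`, section nodes. [folklore] -/
theorem lam_of_not_isConn (hW : ¬ W.card ≤ 1) (h : ¬ IsConn G W c) :
    lam R G W c = (parts G W c).attach.sup fun K => lam R G K.1 c := by
  rw [lam]; simp [hW, h]

/-- The chain product is at least `1`. [folklore] -/
theorem one_le_lam (R : Refiner k) (G : SimpleGraph (Fin k)) (W : Finset (Fin k)) (c : Fin k → ℕ) : 1 ≤ lam R G W c := by
  suffices H : ∀ (n m : ℕ) (W : Finset (Fin k)) (c : Fin k → ℕ), W.card = n → W.card - (W.image c).card = m → 1 ≤ lam R G W c from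
    H _ _ W c rfl rfl
  intro n
  induction n using Nat.strong_induction_on with
  | _ n ihn =>
  intro m
  induction m using Nat.strong_induction_on with
  | _ m ihm =>
  intro W c hn hm
  by_cases hW : W.card ≤ 1
  · rw [lam_of_card_le_one hW]
  by_cases hconn : IsConn G W c
  · by_cases hA : (bigMinCell W c).Nonempty
    · rw [lam_of_isConn hW hconn hA]
      obtain ⟨x, hx⟩ := hA
      have h1 : 1 ≤ lam R G W (R.refine G W (individualize c x)) := ihm _ (hm ▸ measure_lt_of_mem_bigMinCell R G W c hx) W _ hn rfl
      have h2 := le_sup (f := fun x : {x // x ∈ bigMinCell W c} => lam R G W (R.refine G W (individualize c x.1))) (mem_attach _ ⟨x, hx⟩)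
      exact Nat.mul_le_mul (card_pos.2 ⟨x, hx⟩) (h1.trans h2)
    · rw [lam_of_isConn_of_not_nonempty hW hconn hA]
  · rw [lam_of_not_isConn hW hconn]
    obtain ⟨u, hu⟩ : W.Nonempty := card_pos.1 (by omega)
    have hK : comp G W c u ∈ parts G W c := mem_image_of_mem _ hu
    have h1 : 1 ≤ lam R G (comp G W c u) c := ihn _ (hn ▸ card_lt_of_mem_parts hconn hK) _ _ c rfl rfl
    exact h1.trans (le_sup (f := fun K : {K // K ∈ parts G W c} => lam R G K.1 c) (mem_attach _ ⟨_, hK⟩))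

/-- The parts of a state partition it: their sizes add up to `|W|`. [folklore] -/
theorem sum_card_parts (G : SimpleGraph (Fin k)) (W : Finset (Fin k)) (c : Fin k → ℕ) : ∑ K ∈ parts G W c, K.card = W.card := by
  rw [← card_biUnion]
  · congr 1
    ext v
    simp only [mem_biUnion, parts, mem_image]
    exact ⟨fun ⟨K, ⟨u, hu, hK⟩, hv⟩ => by rw [← hK] at hv; exact comp_subset u hv, fun hv => ⟨_, ⟨v, hv, rfl⟩, mem_comp_self hv⟩⟩
  · intro K hK K' hK' hne
    obtain ⟨u, -, rfl⟩ := mem_image.1 hK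
    obtain ⟨u', -, rfl⟩ := mem_image.1 hK'
    exact disjoint_left.2 fun w hw hw' => hne ((comp_eq_of_mem hw).symm.trans (comp_eq_of_mem hw'))

/-- A disconnected state with two vertices has at least two parts. [folklore] -/
theorem two_le_card_parts (hW : ¬ W.card ≤ 1) (h : ¬ IsConn G W c) : 2 ≤ (parts G W c).card := by
  unfold IsConn at h
  push Not at h
  obtain ⟨u, hu, v, hv, huv⟩ := h
  have hne : comp G W c u ≠ comp G W c v := fun e => huv (mem_comp.1 (e ▸ mem_comp_self hv)).2
  have _ := hW
  calc 2 = ({comp G W c u, comp G W c v} : Finset _).card := (card_pair hne).symm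
    _ ≤ (parts G W c).card := card_le_card (by
        intro K hK; simp only [mem_insert, mem_singleton] at hK
        rcases hK with rfl | rfl <;> exact mem_image_of_mem _ ‹_›)

/-- **Sections are additive**: `cost + 1 ≤ 2 |W| · lam`. [cite: Laubner2011, §3.5 (`|T| ≤ 2 d₁ ⋯ d_h`)] -/
theorem cost_succ_le (R : Refiner k) (G : SimpleGraph (Fin k)) {W : Finset (Fin k)} (hWne : W.Nonempty) (c : Fin k → ℕ) :
    cost R G W c + 1 ≤ 2 * W.card * lam R G W c := by
  suffices H : ∀ (n m : ℕ) (W : Finset (Fin k)) (c : Fin k → ℕ), W.card = n → W.card - (W.image c).card = m → W.Nonempty →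
      cost R G W c + 1 ≤ 2 * W.card * lam R G W c from H _ _ W c rfl rfl hWne
  intro n
  induction n using Nat.strong_induction_on with
  | _ n ihn =>
  intro m
  induction m using Nat.strong_induction_on with
  | _ m ihm =>
  intro W c hn hm hWne
  have hWpos : 1 ≤ W.card := card_pos.2 hWne
  by_cases hW : W.card ≤ 1
  · rw [cost_of_card_le_one hW, lam_of_card_le_one hW]; omega
  by_cases hconn : IsConn G W c
  · by_cases hA : (bigMinCell W c).Nonempty
    · rw [cost_of_isConn hW hconn hA, lam_of_isConn hW hconn hA]
      set M := (bigMinCell W c).attach.sup fun x => lam R G W (R.refine G W (individualize c x.1)) with hM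
      have hA2 : 2 ≤ (bigMinCell W c).card := by
        obtain ⟨x, hx⟩ := hA
        rw [bigMinCell_eq_cell hx]
        exact (mem_bigMinCell.1 hx).2.1
      have hsum : ∑ x ∈ (bigMinCell W c).attach, (cost R G W (R.refine G W (individualize c x.1)) + 1) ≤
          ∑ x ∈ (bigMinCell W c).attach, 2 * W.card * M := by
        refine sum_le_sum fun x _ => ?_
        have h1 := ihm _ (hm ▸ measure_lt_of_mem_bigMinCell R G W c x.2) W _ hn rfl hWne
        exact h1.trans (Nat.mul_le_mul_left _ (le_sup (f := fun x : {x // x ∈ bigMinCell W c} =>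
          lam R G W (R.refine G W (individualize c x.1))) (mem_attach _ x)))
      rw [sum_add_distrib, sum_const, smul_eq_mul, mul_one, card_attach, sum_const, smul_eq_mul, card_attach] at hsum
      have hA1 : (bigMinCell W c).card * (2 * W.card * M) = 2 * W.card * ((bigMinCell W c).card * M) := by ring
      omega
    · rw [cost_of_isConn_of_not_nonempty hW hconn hA, lam_of_isConn_of_not_nonempty hW hconn hA]; omega
  · rw [cost_of_not_isConn hW hconn, lam_of_not_isConn hW hconn]
    have key : ∀ M : ℕ, (∀ K : {K // K ∈ parts G W c}, lam R G K.1 c ≤ M) →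
        (1 + ∑ K ∈ (parts G W c).attach, cost R G K.1 c) + 1 ≤ 2 * W.card * M := by
      intro M hle
      have hsum : ∑ K ∈ (parts G W c).attach, (cost R G K.1 c + 1) ≤ ∑ K ∈ (parts G W c).attach, 2 * K.1.card * M := by
        refine sum_le_sum fun K _ => ?_
        obtain ⟨u, hu, hKu⟩ := mem_image.1 K.2
        have hKne : K.1.Nonempty := ⟨u, hKu ▸ mem_comp_self hu⟩
        have h1 := ihn _ (hn ▸ card_lt_of_mem_parts hconn K.2) _ K.1 c rfl rfl hKne
        exact h1.trans (Nat.mul_le_mul_left _ (hle K))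
      have hparts : ∑ K ∈ (parts G W c).attach, 2 * K.1.card * M = 2 * W.card * M := by
        rw [← sum_card_parts G W c, mul_sum, sum_mul, sum_attach (parts G W c) fun K => 2 * K.card * M]
      have h2 := two_le_card_parts hW hconn
      rw [sum_add_distrib, sum_const, smul_eq_mul, mul_one, card_attach, hparts] at hsum
      omega
    exact key _ fun K => le_sup (f := fun K : {K // K ∈ parts G W c} => lam R G K.1 c) (mem_attach _ K)

/-- **The chain product of a state is at most the largest chain product of its final parts.** [folklore] -/
theorem lam_le_sup_fparts (R : Refiner k) (G : SimpleGraph (Fin k)) :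
    ∀ (W : Finset (Fin k)) (c : Fin k → ℕ), lam R G W c ≤ (fparts G W c).sup fun K => lam R G K c := by
  intro W
  induction W using Finset.strongInduction with
  | H W ih =>
  intro c
  by_cases h : IsConn G W c ∨ W.card ≤ 1
  · rw [fparts_of_stop h, sup_singleton]
  · have hW : ¬ W.card ≤ 1 := fun h' => h (Or.inr h')
    have hconn : ¬ IsConn G W c := fun h' => h (Or.inl h')
    rw [lam_of_not_isConn hW hconn, fparts_of_not_stop h, sup_biUnion]
    refine Finset.sup_le fun K _ => ?_
    have hlt := card_lt_of_mem_parts hconn K.2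
    have hsub : K.1 ⊆ W := by obtain ⟨u, -, hK⟩ := mem_image.1 K.2; rw [← hK]; exact comp_subset u
    exact (ih K.1 (hsub.ssubset_of_ne fun e => by rw [e] at hlt; exact lt_irrefl _ hlt) c).trans
      (le_sup (f := fun K : {K // K ∈ parts G W c} => (fparts G K.1 c).sup fun K => lam R G K c) (mem_attach _ K))

end CGCanon

end

end Literature.Computability.Complexity
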